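import Summits.AtomisticToContinuum.HydrodynamicLimit.Theses.LimitCollisionMeasure
import Summits.AtomisticToContinuum.HydrodynamicLimit.Theorems.InformationPercolationEngineChaosClosesEulerCollisionInvariance
import Summits.AtomisticToContinuum.HydrodynamicLimit.Theorems.InformationPercolationEngineChaosClosesEulerWindowedInvariance
import Summits.AtomisticToContinuum.HydrodynamicLimit.Theorems.InformationPercolationEngineChaosClosesEulerMassBalance
import Literature.Analysis.FluidPDE.EmpiricalCollisionMeasure
import Literature.Analysis.FluidPDE.HardSphereCollisionEnumeration
import Literature.Analysis.FluidPDE.HardSphereDynamicsProofs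
import HarnessLib

/-!
# Bogolyubov's microscopic Enskog identity along one hard-sphere trajectory (crux `ChaosClosesEuler`,
stmt-AtomisticToContinuum-15141, line `Sketch`, stub `stub_empiricalEnskogIdentity`)

WHAT. The registered stub `stub_empiricalEnskogIdentity` of the line `Sketch` on the crux
`InformationPercolationEngine.ChaosClosesEuler`; its type is VERBATIM the route item
`LimitCollisionMeasure.EmpiricalEnskogIdentity` (stmt-AtomisticToContinuum-13356): along ONE good orbit
`γ s = Φ.flow s z` of a hard-sphere flow on `𝕋³` (`0 < ε < 1/2`, any `N`), for `a ∈ C¹(ℝ)`, `b` smooth on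
`𝕋³`, `c` continuous on `ℝ³` and the empirical measures `μ_s = N⁻¹ Σᵢ δ_{(xᵢ(s), vᵢ(s))}`,
`a(τ)⟨μ_τ, b c⟩ − a(0)⟨μ_0, b c⟩ − ∫₀^τ [a′⟨μ_s, b c⟩ + a⟨μ_s, (v·∇b) c⟩] ds
  = N⁻¹ ∫ a(t) b(x) [c(v⁺) − c(v⁻)] dκ(t, x, ω, v⁻, v*⁻)`,
`κ` the (unnormalised) empirical collision measure of the orbit over the collisions in `(0, τ]`, whose marks
carry the PRE-collisional pair and `v⁺ = (reflectVel ω (v⁻, v*⁻)).1`.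

PROOF. `⟨μ_s, b c⟩ = N⁻¹ Σᵢ b(xᵢ(s)) c(vᵢ(s))` (`integral_empiricalMeasure`). Trajectory level
(`stretch_free`): on `[u, w]` with `(u, w)` collision-free the orbit is the free flight from `γ u` on `[u, w)`
(`vel_eq_of_free`, `pos_eq_of_free`: positions follow it up to `w` included), and the left limit at `w` is its
value at `w` (`leftLim_eq_freeFlight`); `s ↦ a(s) Σᵢ b(xᵢ(u) + proj((s − u)vᵢ)) c(vᵢ)` is `C¹` with derivative
`a′ Σ b c + a Σᵢ (Σₖ vᵢₖ ∂ₖb) c` (chain rule along a free flight, `hasDerivAt_comp_freeFlight`), so the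
fundamental theorem of calculus gives `a(w) Σᵢ b(xᵢ(w)) c(vᵢ(w⁻)) − a(u) X(u) = ∫_u^w (a′X + aY)`, and
`a(w) X(w)` differs from the first term by the jump `a(w) Σᵢ b(xᵢ(w)) (c(vᵢ(w)) − c(vᵢ(w⁻)))`, which
vanishes unless `w` is a collision time (`leftLim_eq_of_not_mem`). Gluing (`stretch_add`:
`∫_u^w = ∫_u^v + ∫_v^w`, `finsum_mem_union`) and induction on the number of collision times in `(u, w]`
(`stretch_pieces`: split at the last collision time `τ` and at a non-collision time just before it,
`exists_Ioo_left_free`) give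
`a(w)X(w) − a(u)X(u) = ∫_u^w (a′X + aY) + Σ_{s ∈ C ∩ (u,w]} a(s) Σᵢ b(xᵢ(s)) (c(vᵢ(s)) − c(vᵢ(s⁻)))`.
Collision side: `HardSphereFlow.integral_empiricalCollisionMeasure_eq_finsum_ite` unfolds `∫ … dκ` to the
ordered-contact-pair sum; the recorded reflection is undone by `reflectVel_unit_pre_fst`, and at each collision
time the ordered-pair sum is the all-particle jump sum (`pairSum_eq_particleSum`: the recorded pre-collisional
velocity is the left limit, non-participants do not jump).

REFERENCES. N. N. Bogolyubov, *Microscopic solutions of the Boltzmann–Enskog equation in kinetic theory for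
elastic balls*, Theor. Math. Phys. 24 (1975) 804–807; M. Pulvirenti, S. Simonella, *On the evolution of the
empirical measure for the hard-sphere dynamics*, arXiv:1504.03215, §1 (1.3)–(1.5), §3 Thm 1.
-/

noncomputable section

namespace Summit.AtomisticToContinuum.HydrodynamicLimit.Theorems.ChaosClosesEulerEnskogIdentity

open scoped BigOperators Topology Classical MeasureTheory ENNReal InnerProductSpace
open Filter Set MeasureTheory
open Literature.MathematicalPhysics.KineticTheory
open Literature.Analysis.FluidPDE
open Literature.Analysis.FunctionSpaces
open Summit.AtomisticToContinuum.HydrodynamicLimit.Theorems.ChaosClosesEulerMassBalance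
open Summit.AtomisticToContinuum.HydrodynamicLimit.Theorems.ChaosClosesEulerCollisionInvariance
open Summit.AtomisticToContinuum.HydrodynamicLimit.Theorems.ChaosClosesEulerWindowedInvariance

/-! ## §1 Calculus along a free flight -/

/-- **Chain rule along a free flight, time-independent field.** For `b` smooth on `𝕋³`,
`s ↦ b(x₀ + proj((s − u)v))` has derivative `Σₖ vₖ ∂ₖb` at the moving point (the space-time chain rule
`hasDerivAt_comp_freeFlight` for the constant-in-time field `(s, x) ↦ b x`). [folklore] -/
theorem hasDerivAt_comp_freeFlight_space {b : T3 → ℝ} (hb : Torus.IsSmooth b) (x₀ : T3) (v : V3)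
    (u s : ℝ) :
    HasDerivAt (fun s' => b (x₀ + Torus.proj ((s' - u) • v)))
      (∑ k : Fin 3, v k * Torus.partialDeriv k b (x₀ + Torus.proj ((s - u) • v))) s := by
  have hφ : Torus.IsSmoothSpaceTimeOn Set.univ (fun _ : ℝ => b) := by
    have h : ContDiff ℝ ((⊤ : ℕ∞) : WithTop ℕ∞) (Torus.stLift (fun _ : ℝ => b)) :=
      hb.comp contDiff_snd
    exact h.contDiffOn
  have h := hasDerivAt_comp_freeFlight hφ x₀ v u s
  simpa only [deriv_const, zero_add] using h

/-- **The test functional along a free flight is `C¹`.** For `a ∈ C¹`, `b` smooth, frozen velocities `vᵢ` and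
positions `xᵢ + proj((s − u)vᵢ)`, `s ↦ a(s) Σᵢ b(xᵢ(s)) c(vᵢ)` has derivative
`a′(s) Σᵢ b c + a(s) Σᵢ (Σₖ vᵢₖ ∂ₖb) c` (product rule and `hasDerivAt_comp_freeFlight_space`). [folklore] -/
theorem hasDerivAt_testFunctional {n : ℕ} {a : ℝ → ℝ} (ha : ContDiff ℝ 1 a) {b : T3 → ℝ}
    (hb : Torus.IsSmooth b) (c : V3 → ℝ) (x : Fin n → T3) (v : Fin n → V3) (u s : ℝ) :
    HasDerivAt (fun s' => a s' * ∑ i, b (x i + Torus.proj ((s' - u) • v i)) * c (v i))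
      (deriv a s * ∑ i, b (x i + Torus.proj ((s - u) • v i)) * c (v i)
        + a s * ∑ i, (∑ k : Fin 3, v i k * Torus.partialDeriv k b (x i + Torus.proj ((s - u) • v i)))
          * c (v i)) s := by
  have ha' : HasDerivAt a (deriv a s) s := ((ha.differentiable one_ne_zero).differentiableAt).hasDerivAt
  exact ha'.mul (HasDerivAt.fun_sum fun i _ => (hasDerivAt_comp_freeFlight_space hb (x i) (v i) u s).mul_const _)

/-- The derivative of the test functional along a free flight is continuous in time. [folklore] -/
theorem continuous_testFunctionalDeriv {n : ℕ} {a : ℝ → ℝ} (ha : ContDiff ℝ 1 a) {b : T3 → ℝ}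
    (hb : Torus.IsSmooth b) {c : V3 → ℝ} (x : Fin n → T3) (v : Fin n → V3) (u : ℝ) :
    Continuous fun s => deriv a s * ∑ i, b (x i + Torus.proj ((s - u) • v i)) * c (v i)
        + a s * ∑ i, (∑ k : Fin 3, v i k * Torus.partialDeriv k b (x i + Torus.proj ((s - u) • v i)))
          * c (v i) := by
  have hmv : ∀ i, Continuous fun s : ℝ => x i + Torus.proj ((s - u) • v i) := fun i =>
    continuous_const.add (Torus.continuous_proj.comp ((continuous_id.sub continuous_const).smul
      continuous_const))
  refine ((ha.continuous_deriv le_rfl).mul (continuous_finsetSum _ fun i _ =>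
    (hb.continuous.comp (hmv i)).mul continuous_const)).add (ha.continuous.mul
      (continuous_finsetSum _ fun i _ => (continuous_finsetSum _ fun k _ =>
        continuous_const.mul ((hb.partialDeriv k).continuous.comp (hmv i))).mul continuous_const))

/-! ## §2 The identity along one hard-sphere trajectory -/

section Trajectory

variable {n : ℕ} {ε : ℝ} {γ : ℝ → Config n (Fin 3) T3}

/-- **Free stretch.** On `[u, w]` with `(u, w)` collision-free: the balance
`a(w)X(w) − a(u)X(u) = ∫_u^w (a′X + aY) + Σ_{s ∈ C ∩ (u, w]} a(s) J(s)`, `X = Σᵢ b(xᵢ)c(vᵢ)`,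
`Y = Σᵢ (Σₖ vᵢₖ∂ₖb)(xᵢ) c(vᵢ)`, `J(s) = Σᵢ b(xᵢ(s))(c(vᵢ(s)) − c(vᵢ(s⁻)))` (only `s = w` can contribute),
together with the interval integrability of the integrand (FTC for the free-flight functional, whose value at
`w` reads the left-limit velocities). [folklore] -/
theorem stretch_free (hγ : IsHardSphereTrajectory (Torus.geometry (Fin 3)) ε n γ)
    {a : ℝ → ℝ} (ha : ContDiff ℝ 1 a) {b : T3 → ℝ} (hb : Torus.IsSmooth b) (c : V3 → ℝ)
    {u w : ℝ} (huw : u ≤ w)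
    (hfree : ∀ s ∈ Set.Ioo u w, s ∉ collisionTimes (Torus.geometry (Fin 3)) ε γ) :
    IntervalIntegrable (fun s => deriv a s * ∑ i, b (γ s i).1 * c (γ s i).2
        + a s * ∑ i, (∑ k : Fin 3, (γ s i).2 k * Torus.partialDeriv k b (γ s i).1) * c (γ s i).2)
      volume u w ∧
    a w * ∑ i, b (γ w i).1 * c (γ w i).2 - a u * ∑ i, b (γ u i).1 * c (γ u i).2 =
      (∫ s in u..w, (deriv a s * ∑ i, b (γ s i).1 * c (γ s i).2
        + a s * ∑ i, (∑ k : Fin 3, (γ s i).2 k * Torus.partialDeriv k b (γ s i).1) * c (γ s i).2))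
      + ∑ᶠ s ∈ collisionTimes (Torus.geometry (Fin 3)) ε γ ∩ Set.Ioc u w,
          a s * ∑ i, b (γ s i).1 * (c (γ s i).2 - c (Function.leftLim γ s i).2) := by
  have hGt : ∀ x : T3, Continuous ((Torus.geometry (Fin 3)).translate x) :=
    Torus.continuous_geometry_translate
  rcases eq_or_lt_of_le huw with rfl | hlt
  · refine ⟨IntervalIntegrable.refl, ?_⟩
    rw [intervalIntegral.integral_same, Set.Ioc_self, Set.inter_empty, finsum_mem_empty, sub_self, add_zero]
  -- kinematics on the stretch
  have hpos : ∀ s ∈ Set.Icc u w, ∀ i, (γ s i).1 = (γ u i).1 + Torus.proj ((s - u) • (γ u i).2) :=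
    fun s hs i => pos_eq_of_free hγ hfree hs i
  have hvel : ∀ s ∈ Set.Ico u w, ∀ i, (γ s i).2 = (γ u i).2 := fun s hs i => vel_eq_of_free hγ hfree hs i
  have hleft : ∀ i, (Function.leftLim γ w i).2 = (γ u i).2 := fun i => by
    rw [hγ.leftLim_eq_freeFlight hGt hlt hfree, freeFlight_apply]
  -- FTC for the free-flight functional
  have hD := fun s => hasDerivAt_testFunctional ha hb c (fun i => (γ u i).1) (fun i => (γ u i).2) u s
  have hDc := continuous_testFunctionalDeriv (c := c) ha hb (fun i => (γ u i).1) (fun i => (γ u i).2) u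
  have hftc := intervalIntegral.integral_eq_sub_of_hasDerivAt (fun s _ => hD s) (hDc.intervalIntegrable u w)
  -- the trajectory integrand agrees with the free-flight derivative off the right endpoint
  have hEq : Set.EqOn (fun s => deriv a s * ∑ i, b (γ s i).1 * c (γ s i).2
        + a s * ∑ i, (∑ k : Fin 3, (γ s i).2 k * Torus.partialDeriv k b (γ s i).1) * c (γ s i).2)
      (fun s => deriv a s * ∑ i, b ((γ u i).1 + Torus.proj ((s - u) • (γ u i).2)) * c (γ u i).2
        + a s * ∑ i, (∑ k : Fin 3, (γ u i).2 k
          * Torus.partialDeriv k b ((γ u i).1 + Torus.proj ((s - u) • (γ u i).2))) * c (γ u i).2)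
      (Set.Ioo u w) := by
    intro s hs
    simp only [hpos s ⟨hs.1.le, hs.2.le⟩, hvel s ⟨hs.1.le, hs.2⟩]
  refine ⟨(hDc.intervalIntegrable u w).congr_uIoo (by rw [Set.uIoo_of_le hlt.le]; exact hEq.symm), ?_⟩
  -- the jump sum: only `w` can contribute, and it does not if `w` is not a collision time
  have hjump : ∑ᶠ s ∈ collisionTimes (Torus.geometry (Fin 3)) ε γ ∩ Set.Ioc u w,
        a s * ∑ i, b (γ s i).1 * (c (γ s i).2 - c (Function.leftLim γ s i).2) =
      a w * ∑ i, b (γ w i).1 * (c (γ w i).2 - c (Function.leftLim γ w i).2) := by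
    by_cases hw : w ∈ collisionTimes (Torus.geometry (Fin 3)) ε γ
    · have hset : collisionTimes (Torus.geometry (Fin 3)) ε γ ∩ Set.Ioc u w = {w} := by
        ext s
        refine ⟨fun hs => ?_, fun hs => ?_⟩
        · rcases hs.2.2.eq_or_lt with h | h
          · exact h
          · exact absurd hs.1 (hfree s ⟨hs.2.1, h⟩)
        · rw [Set.mem_singleton_iff.1 hs]
          exact ⟨hw, hlt, le_rfl⟩
      rw [hset, finsum_mem_singleton]
    · have hset : collisionTimes (Torus.geometry (Fin 3)) ε γ ∩ Set.Ioc u w = ∅ := by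
        ext s
        simp only [Set.mem_inter_iff, Set.mem_empty_iff_false, iff_false, not_and]
        intro hsC hs
        rcases hs.2.eq_or_lt with h | h
        · exact hw (h ▸ hsC)
        · exact hfree s ⟨hs.1, h⟩ hsC
      rw [hset, finsum_mem_empty, hγ.leftLim_eq_of_not_mem hGt hw]
      simp
  have hsplit : ∑ i, b (γ w i).1 * (c (γ w i).2 - c (Function.leftLim γ w i).2) =
      ∑ i, b (γ w i).1 * c (γ w i).2 - ∑ i, b (γ w i).1 * c (Function.leftLim γ w i).2 := by
    rw [← Finset.sum_sub_distrib]
    simp only [mul_sub]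
  have hW : ∑ i, b ((γ u i).1 + Torus.proj ((w - u) • (γ u i).2)) * c (γ u i).2 =
      ∑ i, b (γ w i).1 * c (Function.leftLim γ w i).2 :=
    Finset.sum_congr rfl fun i _ => by rw [hpos w ⟨hlt.le, le_rfl⟩ i, hleft i]
  have hU : ∑ i, b ((γ u i).1 + Torus.proj ((u - u) • (γ u i).2)) * c (γ u i).2 =
      ∑ i, b (γ u i).1 * c (γ u i).2 :=
    Finset.sum_congr rfl fun i _ => by rw [sub_self, zero_smul, Torus.proj_zero, add_zero]
  rw [intervalIntegral.integral_congr_Ioo_of_le hlt.le hEq, hftc, hjump, hsplit, hW, hU]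
  ring

/-- **Gluing two adjacent stretches.** The balance on `[u, v]` and on `[v, w]` give the balance on `[u, w]`
(`∫_u^w = ∫_u^v + ∫_v^w`; the collision times of `(u, w]` are the disjoint union of those of `(u, v]` and
`(v, w]`, both finite). [folklore] -/
theorem stretch_add (hγ : IsHardSphereTrajectory (Torus.geometry (Fin 3)) ε n γ)
    (a : ℝ → ℝ) (b : T3 → ℝ) (c : V3 → ℝ) {u v w : ℝ} (huv : u ≤ v) (hvw : v ≤ w)
    (h₁ : IntervalIntegrable (fun s => deriv a s * ∑ i, b (γ s i).1 * c (γ s i).2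
        + a s * ∑ i, (∑ k : Fin 3, (γ s i).2 k * Torus.partialDeriv k b (γ s i).1) * c (γ s i).2)
      volume u v ∧
    a v * ∑ i, b (γ v i).1 * c (γ v i).2 - a u * ∑ i, b (γ u i).1 * c (γ u i).2 =
      (∫ s in u..v, (deriv a s * ∑ i, b (γ s i).1 * c (γ s i).2
        + a s * ∑ i, (∑ k : Fin 3, (γ s i).2 k * Torus.partialDeriv k b (γ s i).1) * c (γ s i).2))
      + ∑ᶠ s ∈ collisionTimes (Torus.geometry (Fin 3)) ε γ ∩ Set.Ioc u v,
          a s * ∑ i, b (γ s i).1 * (c (γ s i).2 - c (Function.leftLim γ s i).2))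
    (h₂ : IntervalIntegrable (fun s => deriv a s * ∑ i, b (γ s i).1 * c (γ s i).2
        + a s * ∑ i, (∑ k : Fin 3, (γ s i).2 k * Torus.partialDeriv k b (γ s i).1) * c (γ s i).2)
      volume v w ∧
    a w * ∑ i, b (γ w i).1 * c (γ w i).2 - a v * ∑ i, b (γ v i).1 * c (γ v i).2 =
      (∫ s in v..w, (deriv a s * ∑ i, b (γ s i).1 * c (γ s i).2
        + a s * ∑ i, (∑ k : Fin 3, (γ s i).2 k * Torus.partialDeriv k b (γ s i).1) * c (γ s i).2))
      + ∑ᶠ s ∈ collisionTimes (Torus.geometry (Fin 3)) ε γ ∩ Set.Ioc v w,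
          a s * ∑ i, b (γ s i).1 * (c (γ s i).2 - c (Function.leftLim γ s i).2)) :
    IntervalIntegrable (fun s => deriv a s * ∑ i, b (γ s i).1 * c (γ s i).2
        + a s * ∑ i, (∑ k : Fin 3, (γ s i).2 k * Torus.partialDeriv k b (γ s i).1) * c (γ s i).2)
      volume u w ∧
    a w * ∑ i, b (γ w i).1 * c (γ w i).2 - a u * ∑ i, b (γ u i).1 * c (γ u i).2 =
      (∫ s in u..w, (deriv a s * ∑ i, b (γ s i).1 * c (γ s i).2
        + a s * ∑ i, (∑ k : Fin 3, (γ s i).2 k * Torus.partialDeriv k b (γ s i).1) * c (γ s i).2))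
      + ∑ᶠ s ∈ collisionTimes (Torus.geometry (Fin 3)) ε γ ∩ Set.Ioc u w,
          a s * ∑ i, b (γ s i).1 * (c (γ s i).2 - c (Function.leftLim γ s i).2) := by
  obtain ⟨hi₁, he₁⟩ := h₁
  obtain ⟨hi₂, he₂⟩ := h₂
  refine ⟨hi₁.trans hi₂, ?_⟩
  have hfin : ∀ s t : ℝ, (collisionTimes (Torus.geometry (Fin 3)) ε γ ∩ Set.Ioc s t).Finite := fun s t =>
    (hγ.locFinite s t).subset (Set.inter_subset_inter_right _ Set.Ioc_subset_Icc_self)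
  have hunion : collisionTimes (Torus.geometry (Fin 3)) ε γ ∩ Set.Ioc u w =
      collisionTimes (Torus.geometry (Fin 3)) ε γ ∩ Set.Ioc u v
        ∪ collisionTimes (Torus.geometry (Fin 3)) ε γ ∩ Set.Ioc v w := by
    rw [← Set.inter_union_distrib_left, Set.Ioc_union_Ioc_eq_Ioc huv hvw]
  have hdisj : Disjoint (collisionTimes (Torus.geometry (Fin 3)) ε γ ∩ Set.Ioc u v)
      (collisionTimes (Torus.geometry (Fin 3)) ε γ ∩ Set.Ioc v w) :=
    Set.disjoint_left.2 fun s hs₁ hs₂ => (not_lt.2 hs₁.2.2) hs₂.2.1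
  rw [← intervalIntegral.integral_add_adjacent_intervals hi₁ hi₂, hunion,
    finsum_mem_union hdisj (hfin u v) (hfin v w)]
  linear_combination he₁ + he₂

/-- **The identity along a hard-sphere trajectory, piece by piece.** Induction on the number of collision
times in `(u, w]`: split at the last collision time `τ` (after it the stretch is free) and at a non-collision
time `v < τ` with `(v, τ)` free (`exists_Ioo_left_free`); `(u, v]` has fewer collision times. [folklore] -/
theorem stretch_pieces (hγ : IsHardSphereTrajectory (Torus.geometry (Fin 3)) ε n γ)
    {a : ℝ → ℝ} (ha : ContDiff ℝ 1 a) {b : T3 → ℝ} (hb : Torus.IsSmooth b) (c : V3 → ℝ) :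
    ∀ (m : ℕ) {u w : ℝ}, u ≤ w → (collisionTimes (Torus.geometry (Fin 3)) ε γ ∩ Set.Ioc u w).ncard ≤ m →
    IntervalIntegrable (fun s => deriv a s * ∑ i, b (γ s i).1 * c (γ s i).2
        + a s * ∑ i, (∑ k : Fin 3, (γ s i).2 k * Torus.partialDeriv k b (γ s i).1) * c (γ s i).2)
      volume u w ∧
    a w * ∑ i, b (γ w i).1 * c (γ w i).2 - a u * ∑ i, b (γ u i).1 * c (γ u i).2 =
      (∫ s in u..w, (deriv a s * ∑ i, b (γ s i).1 * c (γ s i).2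
        + a s * ∑ i, (∑ k : Fin 3, (γ s i).2 k * Torus.partialDeriv k b (γ s i).1) * c (γ s i).2))
      + ∑ᶠ s ∈ collisionTimes (Torus.geometry (Fin 3)) ε γ ∩ Set.Ioc u w,
          a s * ∑ i, b (γ s i).1 * (c (γ s i).2 - c (Function.leftLim γ s i).2) := by
  have hfin : ∀ s t : ℝ, (collisionTimes (Torus.geometry (Fin 3)) ε γ ∩ Set.Ioc s t).Finite := fun s t =>
    (hγ.locFinite s t).subset (Set.inter_subset_inter_right _ Set.Ioc_subset_Icc_self)
  -- no collision time in `(u, w]`: the free stretch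
  have hbase : ∀ {u w : ℝ}, u ≤ w → collisionTimes (Torus.geometry (Fin 3)) ε γ ∩ Set.Ioc u w = ∅ →
      IntervalIntegrable (fun s => deriv a s * ∑ i, b (γ s i).1 * c (γ s i).2
          + a s * ∑ i, (∑ k : Fin 3, (γ s i).2 k * Torus.partialDeriv k b (γ s i).1) * c (γ s i).2)
        volume u w ∧
      a w * ∑ i, b (γ w i).1 * c (γ w i).2 - a u * ∑ i, b (γ u i).1 * c (γ u i).2 =
        (∫ s in u..w, (deriv a s * ∑ i, b (γ s i).1 * c (γ s i).2
          + a s * ∑ i, (∑ k : Fin 3, (γ s i).2 k * Torus.partialDeriv k b (γ s i).1) * c (γ s i).2))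
        + ∑ᶠ s ∈ collisionTimes (Torus.geometry (Fin 3)) ε γ ∩ Set.Ioc u w,
            a s * ∑ i, b (γ s i).1 * (c (γ s i).2 - c (Function.leftLim γ s i).2) := by
    intro u w huw hempty
    refine stretch_free hγ ha hb c huw fun s hs hsC => ?_
    have hmem : s ∈ collisionTimes (Torus.geometry (Fin 3)) ε γ ∩ Set.Ioc u w := ⟨hsC, hs.1, hs.2.le⟩
    rw [hempty] at hmem
    exact hmem
  intro m
  induction m with
  | zero =>
    intro u w huw hcard
    exact hbase huw ((Set.ncard_eq_zero (hfin u w)).1 (Nat.le_zero.1 hcard))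
  | succ m ih =>
    intro u w huw hcard
    by_cases hne : (collisionTimes (Torus.geometry (Fin 3)) ε γ ∩ Set.Ioc u w).Nonempty
    swap
    · exact hbase huw (Set.not_nonempty_iff_eq_empty.1 hne)
    -- the last collision time `τ ∈ (u, w]`
    obtain ⟨τ, hτ, hτmax⟩ := Set.exists_max_image _ (fun s => s) (hfin u w) hne
    have hfreeR : ∀ s ∈ Set.Ioo τ w, s ∉ collisionTimes (Torus.geometry (Fin 3)) ε γ :=
      fun s hs hsC => (not_le.2 hs.1) (hτmax s ⟨hsC, hτ.2.1.trans hs.1, hs.2.le⟩)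
    have hR := stretch_free hγ ha hb c hτ.2.2 hfreeR
    -- a non-collision time `v ∈ [u, τ)` with `(v, τ)` collision-free
    obtain ⟨s₀, hs₀, hfreeL⟩ := hγ.exists_Ioo_left_free τ
    have huv : u ≤ max u ((s₀ + τ) / 2) := le_max_left _ _
    have hvτ : max u ((s₀ + τ) / 2) < τ := max_lt hτ.2.1 (by linarith)
    have hM := stretch_free hγ ha hb c hvτ.le fun s hs =>
      hfreeL s ⟨by linarith [le_max_right u ((s₀ + τ) / 2), hs.1], hs.2⟩
    -- induction hypothesis on `[u, v]`
    have hsub : collisionTimes (Torus.geometry (Fin 3)) ε γ ∩ Set.Ioc u (max u ((s₀ + τ) / 2)) ⊆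
        collisionTimes (Torus.geometry (Fin 3)) ε γ ∩ Set.Ioc u w :=
      Set.inter_subset_inter_right _ (Set.Ioc_subset_Ioc_right (hvτ.le.trans hτ.2.2))
    have hcard' :
        (collisionTimes (Torus.geometry (Fin 3)) ε γ ∩ Set.Ioc u (max u ((s₀ + τ) / 2))).ncard ≤ m := by
      have hss : collisionTimes (Torus.geometry (Fin 3)) ε γ ∩ Set.Ioc u (max u ((s₀ + τ) / 2)) ⊂
          collisionTimes (Torus.geometry (Fin 3)) ε γ ∩ Set.Ioc u w :=
        Set.ssubset_iff_subset_ne.2 ⟨hsub, fun heq => by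
          have hτ' :
              τ ∈ collisionTimes (Torus.geometry (Fin 3)) ε γ ∩ Set.Ioc u (max u ((s₀ + τ) / 2)) := by
            rw [heq]
            exact hτ
          exact (not_lt.2 hτ'.2.2) hvτ⟩
      have := Set.ncard_lt_ncard hss (hfin u w)
      omega
    have hL := ih huv hcard'
    exact stretch_add hγ a b c (huv.trans hvτ.le) hτ.2.2 (stretch_add hγ a b c huv hvτ.le hL hM) hR

end Trajectory

/-! ## §3 The collision side at one collision time -/

/-- At a collision time of a hard-sphere trajectory in a regular geometry, the ordered-contact-pair sum of
`r b(xᵢ) (c(vᵢ) − c(vᵢ⁻))`, `vᵢ⁻ = (reflectVel (xᵢ − xⱼ) (vᵢ, vⱼ)).1` the recorded pre-collisional velocity,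
is `r Σᵢ b(xᵢ(s)) (c(vᵢ(s)) − c(vᵢ(s⁻)))` over all particles (`pairSum_eq_particleSum`). [folklore] -/
theorem pairSum_eq_mul_jump {d : Type*} [Fintype d] {X : Type*} [TopologicalSpace X] [T2Space X]
    {n : ℕ} {G : Geometry d X} {ε : ℝ} {γ : ℝ → Config n d X} (h : IsHardSphereTrajectory G ε n γ)
    (hG : G.IsHardSphereRegular ε) {s : ℝ} (hs : s ∈ collisionTimes G ε γ) (r : ℝ) (b : X → ℝ)
    (c : EuclideanSpace ℝ d → ℝ) :
    (∑ i, ∑ j, if i ≠ j ∧ ‖G.sepVec (γ s i).1 (γ s j).1‖ = ε then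
        r * b (γ s i).1 * (c (γ s i).2 - c (reflectVel (G.sepVec (γ s i).1 (γ s j).1) ((γ s i).2, (γ s j).2)).1)
      else 0) =
      r * ∑ i, b (γ s i).1 * (c (γ s i).2 - c (Function.leftLim γ s i).2) := by
  rw [pairSum_eq_particleSum h hG hs (fun i => r * b (γ s i).1) c, Finset.mul_sum]
  exact Finset.sum_congr rfl fun i _ => mul_assoc _ _ _

/-! ## §4 The registered stub -/

/-- **STUB `stub_empiricalEnskogIdentity` (line `Sketch`, crux `ChaosClosesEuler`, stmt-15141): Bogolyubov's
microscopic Enskog identity along one good orbit, VERBATIM `LimitCollisionMeasure.EmpiricalEnskogIdentity`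
(stmt-AtomisticToContinuum-13356).** For a hard-sphere flow on `𝕋³` (`0 < ε < 1/2`), a good `z`, `τ > 0`,
`a ∈ C¹`, `b` smooth, `c` continuous:
`a(τ)⟨μ_τ, bc⟩ − a(0)⟨μ_0, bc⟩ − ∫₀^τ [a′⟨μ_s, bc⟩ + a⟨μ_s, (v·∇b)c⟩] ds = N⁻¹ ∫ a b (c(v⁺) − c(v⁻)) dκ`
over the collisions in `(0, τ]` (free transport between collisions by the fundamental theorem of calculus,
`stretch_pieces`; the collision integral unfolded by
`HardSphereFlow.integral_empiricalCollisionMeasure_eq_finsum_ite`, the recorded reflection undone by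
`reflectVel_unit_pre_fst`, the ordered-pair sum re-indexed by particles, `pairSum_eq_mul_jump`). [folklore] -/
theorem stub_empiricalEnskogIdentity :
    Summit.AtomisticToContinuum.HydrodynamicLimit.Theses.LimitCollisionMeasure.EmpiricalEnskogIdentity := by
  intro ε N hε hε2 Φ z hz τ hτ a ha b hb c hc
  dsimp only
  have hε2' : ε < 2⁻¹ := by rwa [one_div] at hε2
  have hG := Torus.isHardSphereRegular_geometry (d := Fin 3) hε2'
  have hγ : IsHardSphereTrajectory (Torus.geometry (Fin 3)) ε N (fun s => Φ.flow s z) := Φ.isTrajectory z hz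
  -- the free-transport side: empirical integrals are normalised particle sums
  simp_rw [integral_empiricalMeasure]
  have hI : ∀ s, deriv a s * ((N : ℝ)⁻¹ * ∑ i, b (Φ.flow s z i).1 * c (Φ.flow s z i).2)
      + a s * ((N : ℝ)⁻¹ * ∑ i, (∑ k : Fin 3, (Φ.flow s z i).2 k
        * Torus.partialDeriv k b (Φ.flow s z i).1) * c (Φ.flow s z i).2) =
      (N : ℝ)⁻¹ * (deriv a s * ∑ i, b (Φ.flow s z i).1 * c (Φ.flow s z i).2
        + a s * ∑ i, (∑ k : Fin 3, (Φ.flow s z i).2 k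
          * Torus.partialDeriv k b (Φ.flow s z i).1) * c (Φ.flow s z i).2) := fun s => by ring
  simp_rw [hI]
  rw [integral_const_mul, integral_Icc_eq_integral_Ioc, ← intervalIntegral.integral_of_le hτ.le]
  obtain ⟨-, hcore⟩ := stretch_pieces hγ ha hb c _ hτ.le le_rfl
  -- the collision side: unfold the integral, undo the recorded reflection, re-index by particles
  have hR : ∫ m, a m.1 * b m.2.1 * (c (reflectVel m.2.2.1 (m.2.2.2.1, m.2.2.2.2)).1 - c m.2.2.2.1)
        ∂(Φ.empiricalCollisionMeasure (Set.Ioc 0 τ) z) =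
      ∑ᶠ s ∈ collisionTimes (Torus.geometry (Fin 3)) ε (fun t => Φ.flow t z) ∩ Set.Ioc 0 τ,
        a s * ∑ i, b (Φ.flow s z i).1 *
          (c (Φ.flow s z i).2 - c (Function.leftLim (fun t => Φ.flow t z) s i).2) := by
    refine (Φ.integral_empiricalCollisionMeasure_eq_finsum_ite hz Set.Ioc_subset_Icc_self _).trans
      (finsum_mem_congr rfl fun s hs => ?_)
    rw [← pairSum_eq_mul_jump hγ hG hs.1 (a s) b c]
    refine Finset.sum_congr rfl fun i _ => Finset.sum_congr rfl fun j _ => ?_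
    split_ifs with hij
    · dsimp only
      rw [reflectVel_unit_pre_fst hε]
    · rfl
  rw [hR]
  linear_combination (N : ℝ)⁻¹ * hcore

end Summit.AtomisticToContinuum.HydrodynamicLimit.Theorems.ChaosClosesEulerEnskogIdentity

end
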